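import Summits.QuantumFields.YangMills.Theses.BoundedSkewnessRunning
import Summits.QuantumFields.YangMills.Theorems.BoundedSkewnessRunningWindowFromNontrivialityOS
import Summits.QuantumFields.YangMills.Theorems.BoundedSkewnessRunningWindowFromNontrivialityLattice
import HarnessLib

/-!
# Route `BoundedSkewnessRunning`, support item S2 `WindowFromNontriviality` (stmt-QuantumFields-19899) — closed

If the OS data `T` are the continuum limit of the lattice Yang–Mills data `(r, sch)` (`IsYangMillsFor r sch T`) and the
curvature species is non-trivial (`T.IsNontrivial r.curvature`), then there is a real, compactly supported test function `u`
supported in `{x⁰ < 0}` whose renormalised truncated reflected two-point function `(c_k)² · cruxT r sch u k` converges to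
some `σ > 0`, and which satisfies the RP-doubling window `cruxT r sch u k ≤ M · cruxT r sch (τ₋₁ u) k` eventually.

Proof (`boundedSkewnessRunning_windowFromNontriviality_proof`).  OS side (helper file `…WindowFromNontrivialityOS`): by
non-triviality and the E1-free OS reconstruction there is a real, compactly supported, positive-time `w` whose truncated
one-point vector `ψ_w` is non-zero, and then for every `t ≥ 0` the truncated continuum value
`𝔖₂(θw_t ⊗ w_t) − 𝔖₁(θw_t)𝔖₁(w_t) = ‖e^{-tH}ψ_w‖² > 0` (`e^{-tH}` injective).  Lattice side (helper file
`…WindowFromNontrivialityLattice`): `(c_k)²·cruxT r sch v k` is the renormalised truncated lattice two-point function at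
`(v, θv)`, so `IsYangMillsFor` (arities `2` and `1`, real off-diagonal tensors) makes it converge to that continuum value;
with `u = θw` (`t = 0`) this gives `σ > 0`, and with `τ₋₁u = θ(τ₁w)` (`t = 1`) a positive limit `σ₁` for the shifted pair,
whence eventually `(c_k)² cruxT(u) ≤ σ + 1 ≤ (2(σ+1)/σ₁) · (c_k)² cruxT(τ₋₁u)` and `c_k² > 0` cancels.
YM mass gap is NOT proved here; this is a support item of a tier-B route.

References: Osterwalder–Schrader 1973 §4.1; Glimm–Jaffe Thm. 6.1.3; Osterwalder–Seiler 1978.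
-/

set_option autoImplicit false

noncomputable section

open MeasureTheory Filter Topology
open scoped SchwartzMap
open Literature.MathematicalPhysics.AQFT Literature.MathematicalPhysics.QuantumLattice
open Literature.MathematicalPhysics.QuantumFieldTheory
open Summit.QuantumFields.YangMills.Theorems.SelfNormalisedSkewness.Negative

namespace Summit.QuantumFields.YangMills.Theorems.WindowFromNontriviality

/-- ★★★ **S2 `WindowFromNontriviality` holds**: non-triviality of the continuum curvature two-point function produces a
real, compactly supported, negative-time `u` with a positive renormalised truncated limit `σ` and the RP-doubling window
(see the module docstring for the proof). [cite: GlimmJaffe1987, Thm. 6.1.3] -/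
theorem boundedSkewnessRunning_windowFromNontriviality_proof :
    Summit.QuantumFields.YangMills.Theses.BoundedSkewnessRunning.WindowFromNontriviality := by
  unfold Summit.QuantumFields.YangMills.Theses.BoundedSkewnessRunning.WindowFromNontriviality
  intro G _ _ _ _ _ _ r sch T hYM hNT
  obtain ⟨w, hwc, hws, hdata⟩ := exists_realTest_window_data T r.curvature hNT
  obtain ⟨F₀, A₀, B₀, hF₀, hF₀off, hA₀, hB₀, hpos₀⟩ := hdata 0 le_rfl
  obtain ⟨F₁, A₁, B₁, hF₁, hF₁off, hA₁, hB₁, hpos₁⟩ := hdata 1 zero_le_one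
  rw [timeShiftTest_zero] at hF₀ hA₀ hB₀
  -- the window test function `u = θw` and the shifted pair `(τ₋₁u, θτ₋₁u) = (θτ₁w, τ₁w)`
  set u : 𝓢(E4, ℝ) := thetaTest 4 w with hu
  have hθu : thetaTest 4 u = w := thetaTest_involutive 4 w
  have hshift : timeShiftTest 4 (-1) u = thetaTest 4 (timeShiftTest 4 1 w) := timeShiftTest_neg_thetaTest 1 w
  have hθshift : thetaTest 4 (timeShiftTest 4 (-1) u) = timeShiftTest 4 1 w := by
    rw [hshift]
    exact thetaTest_involutive 4 _
  -- one-point tensors are off-diagonal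
  have hoff1 : ∀ A : 𝓢((Fin 1 → EuclideanSpace ℝ (Fin 4)), ℂ), IsOffDiagonal A := by
    rintro A x ⟨i, j, hij, -⟩
    exact absurd (Subsingleton.elim i j) hij
  -- the five lattice → continuum limits supplied by `IsYangMillsFor`
  have two_ne : (1 + 1 : ℕ) ≠ 0 := by norm_num
  have lim2₀ := hYM (1 + 1) two_ne (fun _ => r.curvature) ![u, thetaTest 4 u] F₀ (by rw [hθu]; exact hF₀) hF₀off
  have lim1a₀ := hYM 1 one_ne_zero (fun _ => r.curvature) ![u] A₀ hA₀ (hoff1 A₀)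
  have lim1b₀ := hYM 1 one_ne_zero (fun _ => r.curvature) ![thetaTest 4 u] B₀ (by rw [hθu]; exact hB₀) (hoff1 B₀)
  have lim2₁ := hYM (1 + 1) two_ne (fun _ => r.curvature)
    ![timeShiftTest 4 (-1) u, thetaTest 4 (timeShiftTest 4 (-1) u)] F₁ (by rw [hθshift, hshift]; exact hF₁) hF₁off
  have lim1a₁ := hYM 1 one_ne_zero (fun _ => r.curvature) ![timeShiftTest 4 (-1) u] A₁ (by rw [hshift]; exact hA₁)
    (hoff1 A₁)
  have lim1b₁ := hYM 1 one_ne_zero (fun _ => r.curvature) ![thetaTest 4 (timeShiftTest 4 (-1) u)] B₁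
    (by rw [hθshift]; exact hB₁) (hoff1 B₁)
  -- the renormalised truncated two-point functions converge (in `ℂ`, then in `ℝ`)
  have re_lim : ∀ {a : ℕ → ℝ} {z : ℂ}, Tendsto (fun k => ((a k : ℝ) : ℂ)) atTop (𝓝 z) →
      Tendsto a atTop (𝓝 z.re) := by
    intro a z h
    exact ((Complex.continuous_re.tendsto z).comp h).congr fun k => Complex.ofReal_re _
  have limR₀ : Tendsto (fun k => (sch.c r.curvature k) ^ 2 * cruxT r sch u k) atTop
      (𝓝 (T.schwinger (1 + 1) (fun _ => r.curvature) F₀ -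
        T.schwinger 1 (fun _ => r.curvature) A₀ * T.schwinger 1 (fun _ => r.curvature) B₀).re) := by
    refine re_lim ((lim2₀.sub (lim1a₀.mul lim1b₀)).congr fun k => ?_)
    rw [sq_c_mul_cruxT]
    push_cast
    ring
  have limR₁ : Tendsto (fun k => (sch.c r.curvature k) ^ 2 * cruxT r sch (timeShiftTest 4 (-1) u) k) atTop
      (𝓝 (T.schwinger (1 + 1) (fun _ => r.curvature) F₁ -
        T.schwinger 1 (fun _ => r.curvature) A₁ * T.schwinger 1 (fun _ => r.curvature) B₁).re) := by
    refine re_lim ((lim2₁.sub (lim1a₁.mul lim1b₁)).congr fun k => ?_)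
    rw [sq_c_mul_cruxT]
    push_cast
    ring
  -- the window
  set σ := (T.schwinger (1 + 1) (fun _ => r.curvature) F₀ -
    T.schwinger 1 (fun _ => r.curvature) A₀ * T.schwinger 1 (fun _ => r.curvature) B₀).re with hσ
  set σ₁ := (T.schwinger (1 + 1) (fun _ => r.curvature) F₁ -
    T.schwinger 1 (fun _ => r.curvature) A₁ * T.schwinger 1 (fun _ => r.curvature) B₁).re with hσ₁
  refine ⟨u, 2 * (σ + 1) / σ₁, σ, hasCompactSupport_thetaTest hwc, tsupport_thetaTest_subset_neg hws, hpos₀, limR₀, ?_⟩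
  have ev1 : ∀ᶠ k in atTop, (sch.c r.curvature k) ^ 2 * cruxT r sch u k < σ + 1 :=
    limR₀.eventually (Iio_mem_nhds (lt_add_one σ))
  have ev2 : ∀ᶠ k in atTop, σ₁ / 2 < (sch.c r.curvature k) ^ 2 * cruxT r sch (timeShiftTest 4 (-1) u) k :=
    limR₁.eventually (Ioi_mem_nhds (by linarith))
  filter_upwards [ev1, ev2] with k hk1 hk2
  have hc2 : 0 < (sch.c r.curvature k) ^ 2 := by
    rcases (sq_nonneg (sch.c r.curvature k)).lt_or_eq with h | h
    · exact h
    · exfalso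
      rw [← h, zero_mul] at hk2
      linarith
  have hM : 0 ≤ 2 * (σ + 1) / σ₁ := div_nonneg (by linarith) hpos₁.le
  refine le_of_mul_le_mul_left ?_ hc2
  calc (sch.c r.curvature k) ^ 2 * cruxT r sch u k ≤ σ + 1 := hk1.le
    _ = 2 * (σ + 1) / σ₁ * (σ₁ / 2) := by field_simp
    _ ≤ 2 * (σ + 1) / σ₁ * ((sch.c r.curvature k) ^ 2 * cruxT r sch (timeShiftTest 4 (-1) u) k) :=
        mul_le_mul_of_nonneg_left hk2.le hM
    _ = (sch.c r.curvature k) ^ 2 * (2 * (σ + 1) / σ₁ * cruxT r sch (timeShiftTest 4 (-1) u) k) := by ring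

end Summit.QuantumFields.YangMills.Theorems.WindowFromNontriviality

end
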